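import Summits.QuantumFields.QCD.Theorems.SpectralDefectExtinctionWindowExtinctionChessboardOddCycle
import Literature.MathematicalPhysics.QuantumFieldTheory.ConstructiveQFTWave0
import HarnessLib

/-!
# Crux `NonSimplyConnectedLatticeGap` (stmt-QuantumFields-16405), line `Sketch`:
# stub (OC) `stub_profileChessboard` — the abstract one-direction chessboard estimate for
# profile functionals on the odd four-torus

Purely combinatorial step of the chessboard (Peierls) bound of the line.  Let `Ψ` be a functional
of profiles `e : Site 4 (2S+1) → ℝ` on the sites of the odd four-torus `(ℤ/(2S+1))⁴`, `S ≥ 1`,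
which on the admissible profiles (pointwise predicate `p₀`) is non-negative, invariant under the
time translations `x ↦ x + a e₀`, and obeys the reflection Schwarz inequality
`Ψ(e)² ≤ Ψ(e⁺) Ψ(e⁻)` for the time reflection `x₀ ↦ 2f - x₀` about a FIXED LAYER `f`: `e⁺` keeps the
layers `[f - S, f]` (`(f - x₀).val ≤ S`) and reflects them onto the rest, `e⁻` keeps the layers
`[f, f + S]` (`(x₀ - f).val ≤ S`).  Then every admissible `c` satisfies
`Ψ(c)^{2S+1} ≤ ∏ₛ Ψ(x ↦ c(x[0 := s]))`.

Route: the landed Fröhlich–Israel–Lieb–Simon maximisation argument on the odd cycle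
`OddCycle.chessboard` (support file `…WindowExtinctionChessboardOddCycle` of crux `WindowExtinction`;
its reflection is `t ↦ 1 - t` with kept closed half `1 ≤ t ≤ S + 1 = cPlus S`), applied to the
functional of time re-indexings `Φ(τ) := Ψ(x ↦ c(x[0 := τ (x₀ - f + m)]))`, `m := S + 1`: the shift
`x₀ ↦ x₀ - f + m` puts the layer `f` at the vertex `m` fixed by `t ↦ 1 - t` and conjugates
`x₀ ↦ 2f - x₀` to `t ↦ 1 - t` (as `2m = 1` in `ℤ/(2S+1)`).  Every re-indexed profile is admissible
(it takes values of `c`), rotation invariance of `Φ` is time-translation invariance of `Ψ`, the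
Schwarz inequality of `Φ` is the hypothesis (the kept halves match: `(m - u).val ≤ S ↔ u ∈ cPlus S`,
`(u - m).val ≤ S ↔ u ∉ cMinus S`), and the conclusion of `OddCycle.chessboard` at the inverse shift
`τ = (· + (f - m))` is the claim after re-indexing the product over the layers.
-/

set_option autoImplicit false

namespace Summit.QuantumFields.YangMills.Theorems.NonSimplyConnectedLatticeGap

open scoped BigOperators
open Literature.MathematicalPhysics.QuantumFieldTheory
open Summit.QuantumFields.QCD.Cruxes.WindowExtinction.ChessboardColdCells

/-- With `m = S + 1 ∈ ℤ/(2S+1)`, `S ≥ 1`: `(m - u).val ≤ S` iff `u` lies in the closed positive half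
`1 ≤ u ≤ S + 1` (`OddCycle.cPlus S`) of the odd cycle. -/
theorem profileChessboard_val_shift_sub_le_iff {S : ℕ} (hS : 1 ≤ S) (u : ZMod (2 * S + 1)) :
    (((S + 1 : ℕ) : ZMod (2 * S + 1)) - u).val ≤ S ↔ u ∈ OddCycle.cPlus S := by
  rw [OddCycle.mem_cPlus]
  have hu := ZMod.val_lt u
  have h1 : ((S + 1 : ℕ) : ZMod (2 * S + 1)) - u =
      ((S + 1 : ℕ) : ZMod (2 * S + 1)) - (u.val : ZMod (2 * S + 1)) := by
    rw [ZMod.natCast_zmod_val]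
  rw [h1, OddCycle.val_natCast_sub_natCast (show S + 1 < 2 * S + 1 by omega) hu]
  split_ifs with h2 <;> omega

/-- With `m = S + 1 ∈ ℤ/(2S+1)`, `S ≥ 1`: `(u - m).val ≤ S` iff `u` lies outside the open positive
half `1 ≤ u ≤ S` (`OddCycle.cMinus S`) of the odd cycle. -/
theorem profileChessboard_val_sub_shift_le_iff {S : ℕ} (hS : 1 ≤ S) (u : ZMod (2 * S + 1)) :
    (u - ((S + 1 : ℕ) : ZMod (2 * S + 1))).val ≤ S ↔ u ∉ OddCycle.cMinus S := by
  rw [OddCycle.mem_cMinus, OddCycle.val_sub_natCast (show S + 1 < 2 * S + 1 by omega)]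
  have hu := ZMod.val_lt u
  split_ifs with h2 <;> omega

/-- `2 (S + 1) = 1` in `ℤ/(2S+1)`: the vertex `S + 1` is the fixed vertex of `t ↦ 1 - t`. -/
theorem profileChessboard_two_mul_shift (S : ℕ) : 2 * ((S + 1 : ℕ) : ZMod (2 * S + 1)) = 1 := by
  have h : ((2 * S + 1 : ℕ) : ZMod (2 * S + 1)) = 0 := ZMod.natCast_self _
  push_cast at h ⊢
  linear_combination h

/-- **STUB OC — abstract odd-cycle chessboard for profile functionals on the odd four-torus**
(pure combinatorics over the landed `OddCycle.chessboard`): a functional `Ψ` of profiles on the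
sites of `(ℤ/(2S+1))⁴`, `S ≥ 1`, which on the admissible profiles (pointwise predicate `p₀`) is
non-negative, invariant under time translation and obeys the reflection Schwarz inequality for the
reflection `x₀ ↦ 2f - x₀` (fixed layer `f` kept once in both halves: `e⁺` keeps
`{(f - x₀).val ≤ S}`, `e⁻` keeps `{(x₀ - f).val ≤ S}`) satisfies, for every admissible `c`,
`Ψ(c)^{2S+1} ≤ ∏ₛ Ψ(x ↦ c(x[0 := s]))`. -/
theorem stub_profileChessboard : ∀ (S : ℕ), 1 ≤ S → ∀ (f : ZMod (2 * S + 1)) (p₀ : ℝ → Prop) (Ψ : (Literature.MathematicalPhysics.QuantumFieldTheory.Site 4 (2 * S + 1) → ℝ) → ℝ), (∀ e : Literature.MathematicalPhysics.QuantumFieldTheory.Site 4 (2 * S + 1) → ℝ, (∀ x, p₀ (e x)) → 0 ≤ Ψ e) → (∀ e : Literature.MathematicalPhysics.QuantumFieldTheory.Site 4 (2 * S + 1) → ℝ, (∀ x, p₀ (e x)) → ∀ a : ZMod (2 * S + 1), Ψ (fun x => e (x + Pi.single 0 a)) = Ψ e) → (∀ e : Literature.MathematicalPhysics.QuantumFieldTheory.Site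 4 (2 * S + 1) → ℝ, (∀ x, p₀ (e x)) → Ψ e ^ 2 ≤ Ψ (fun x => if (f - x 0).val ≤ S then e x else e (Function.update x 0 (2 * f - x 0))) * Ψ (fun x => if (x 0 - f).val ≤ S then e x else e (Function.update x 0 (2 * f - x 0)))) → ∀ c : Literature.MathematicalPhysics.QuantumFieldTheory.Site 4 (2 * S + 1) → ℝ, (∀ x, p₀ (c x)) → Ψ c ^ (2 * S + 1) ≤ ∏ s : ZMod (2 * S + 1), Ψ (fun x => c (Function.update x 0 s)) := by
  intro S hS f p₀ Ψ h0 hT hsch c hc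
  -- the shift `m = S + 1` and the three arithmetic facts about it that are used
  obtain ⟨m, hA, hB, hC⟩ : ∃ m : ZMod (2 * S + 1),
      (∀ u : ZMod (2 * S + 1), (m - u).val ≤ S ↔ u ∈ OddCycle.cPlus S) ∧
      (∀ u : ZMod (2 * S + 1), (u - m).val ≤ S ↔ u ∉ OddCycle.cMinus S) ∧ 2 * m = 1 :=
    ⟨_, profileChessboard_val_shift_sub_le_iff hS, profileChessboard_val_sub_shift_le_iff hS,
      profileChessboard_two_mul_shift S⟩
  -- every re-indexed profile `x ↦ c (x[0 := τ (x 0 - f + m)])` is admissible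
  have hadm : ∀ (τ : ZMod (2 * S + 1) → ZMod (2 * S + 1)) (x : Site 4 (2 * S + 1)),
      p₀ (c (Function.update x 0 (τ (x 0 - f + m)))) := fun τ x => hc _
  -- non-negativity
  have h0' : ∀ τ : ZMod (2 * S + 1) → ZMod (2 * S + 1),
      0 ≤ Ψ (fun x => c (Function.update x 0 (τ (x 0 - f + m)))) :=
    fun τ => h0 (fun x => c (Function.update x 0 (τ (x 0 - f + m)))) (hadm τ)
  -- rotation invariance from time-translation invariance
  have hrot : ∀ (τ : ZMod (2 * S + 1) → ZMod (2 * S + 1)) (a : ZMod (2 * S + 1)),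
      Ψ (fun x => c (Function.update x 0 (τ (x 0 - f + m + a)))) =
        Ψ (fun x => c (Function.update x 0 (τ (x 0 - f + m)))) := by
    intro τ a
    have hpt : ∀ x : Site 4 (2 * S + 1),
        Function.update (x + Pi.single 0 a : Site 4 (2 * S + 1)) 0
            (τ ((x + Pi.single 0 a : Site 4 (2 * S + 1)) 0 - f + m)) =
          Function.update x 0 (τ (x 0 - f + m + a)) := by
      intro x
      funext k
      by_cases hk : k = 0
      · subst hk
        rw [Function.update_self, Function.update_self, Pi.add_apply, Pi.single_eq_same]
        congr 1
        ring
      · simp [hk]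
    have h := hT (fun x => c (Function.update x 0 (τ (x 0 - f + m)))) (hadm τ) a
    refine Eq.trans ?_ h
    congr 1
    funext x
    exact congrArg c (hpt x).symm
  -- the reflection Schwarz inequality: the shifted halves are `plusHalf` / `minusHalf`
  have hsch' : ∀ τ : ZMod (2 * S + 1) → ZMod (2 * S + 1),
      Ψ (fun x => c (Function.update x 0 (τ (x 0 - f + m)))) ^ 2 ≤
        Ψ (fun x => c (Function.update x 0 (OddCycle.plusHalf τ (x 0 - f + m)))) *
          Ψ (fun x => c (Function.update x 0 (OddCycle.minusHalf τ (x 0 - f + m)))) := by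
    intro τ
    -- the shift conjugates `x₀ ↦ 2f - x₀` to `t ↦ 1 - t`
    have hrefl : ∀ x : Site 4 (2 * S + 1), 2 * f - x 0 - f + m = 1 - (x 0 - f + m) := by
      intro x
      linear_combination hC
    have hp : ∀ x : Site 4 (2 * S + 1),
        (if (f - x 0).val ≤ S then c (Function.update x 0 (τ (x 0 - f + m)))
          else c (Function.update (Function.update x 0 (2 * f - x 0)) 0
            (τ (Function.update x 0 (2 * f - x 0) 0 - f + m)))) =
        c (Function.update x 0 (OddCycle.plusHalf τ (x 0 - f + m))) := by
      intro x
      rw [Function.update_idem, Function.update_self]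
      have hiff : (f - x 0).val ≤ S ↔ x 0 - f + m ∈ OddCycle.cPlus S := by
        rw [← hA (x 0 - f + m), show m - (x 0 - f + m) = f - x 0 by ring]
      simp only [OddCycle.plusHalf]
      by_cases hcond : (f - x 0).val ≤ S
      · rw [if_pos hcond, if_pos (hiff.mp hcond)]
      · rw [if_neg hcond, if_neg (mt hiff.mpr hcond), hrefl x]
    have hm : ∀ x : Site 4 (2 * S + 1),
        (if (x 0 - f).val ≤ S then c (Function.update x 0 (τ (x 0 - f + m)))
          else c (Function.update (Function.update x 0 (2 * f - x 0)) 0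
            (τ (Function.update x 0 (2 * f - x 0) 0 - f + m)))) =
        c (Function.update x 0 (OddCycle.minusHalf τ (x 0 - f + m))) := by
      intro x
      rw [Function.update_idem, Function.update_self]
      have hiff : (x 0 - f).val ≤ S ↔ x 0 - f + m ∉ OddCycle.cMinus S := by
        rw [← hB (x 0 - f + m), show x 0 - f + m - m = x 0 - f by ring]
      simp only [OddCycle.minusHalf]
      by_cases hcond : (x 0 - f).val ≤ S
      · rw [if_pos hcond, if_neg (hiff.mp hcond)]
      · rw [if_neg hcond, if_pos (not_not.mp (mt hiff.mpr hcond)), hrefl x]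
    have h := hsch (fun x => c (Function.update x 0 (τ (x 0 - f + m)))) (hadm τ)
    refine h.trans_eq ?_
    congr 1
    · congr 1
      funext x
      exact hp x
    · congr 1
      funext x
      exact hm x
  -- the odd-cycle chessboard estimate at the inverse shift
  have key := OddCycle.chessboard hS
    (fun τ : ZMod (2 * S + 1) → ZMod (2 * S + 1) =>
      Ψ (fun x => c (Function.update x 0 (τ (x 0 - f + m))))) h0' hrot hsch' (fun t => t + (f - m))
  have hL : (fun x : Site 4 (2 * S + 1) => c (Function.update x 0 (x 0 - f + m + (f - m)))) = c := by
    funext x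
    rw [show x 0 - f + m + (f - m) = x 0 by ring, Function.update_eq_self]
  calc Ψ c ^ (2 * S + 1)
      = Ψ (fun x : Site 4 (2 * S + 1) => c (Function.update x 0 (x 0 - f + m + (f - m)))) ^
          (2 * S + 1) := by rw [hL]
    _ ≤ ∏ t : ZMod (2 * S + 1), Ψ (fun x => c (Function.update x 0 (t + (f - m)))) := key
    _ = ∏ s : ZMod (2 * S + 1), Ψ (fun x => c (Function.update x 0 s)) :=
        Fintype.prod_equiv (Equiv.addRight (f - m)) _ _ (fun _ => rfl)

end Summit.QuantumFields.YangMills.Theorems.NonSimplyConnectedLatticeGap
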